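import Mathlib
import Literature.NumberTheory.LFunctions.Zhang2022.Section8aStatements
import Literature.NumberTheory.LFunctions.Zhang2022.Section8Ded81Prelims
import Literature.NumberTheory.LFunctions.Zhang2022.Section5Lemma51
import HarnessLib

/-!
# Zhang (2022) §8 p. 43, step `Z22:§8.u012` ("By Lemma 5.2 and 5.9, `Ĩ₁⁺ − I₁⁺ ≪ 𝓛⁻¹¹⁴∫_{𝔍(α)}|…|`")
# — preliminaries: `|Z(s,ψ)⁻¹|` near the line, the zeros seen from `𝔍(α)`, the integrand algebra,
# and continuity of the two integrands along `𝔍(α)`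

Topic `Literature/NumberTheory/LFunctions/Zhang2022` (Landau–Siegel audit tree; verdict-neutral;
D-0069 campaign node **Z22:§8.u012**, locator [Z22 p.43, §8 proof of Lemma 8.1, tex L2240–L2243]).
Y. Zhang, *Discrete mean estimates and the Landau–Siegel zero*, arXiv:2211.02515v1 (2022)
[Zhang2022LandauSiegel] — **an unrefereed manuscript under adjudication**. The printed step:

> Write `I₁⁺(𝐚₁,𝐚₂;ψ) = (1/2πi)∫_{𝔍(α)} 𝒞(s,ψ)A(𝐚₁;s,ψ)A(𝐚₂,1−s,ψ̄)ω(s) ds`. By Lemma 5.2 and 5.9,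
> `Ĩ₁⁺(𝐚₁,𝐚₂;ψ) − I₁⁺(𝐚₁,𝐚₂;ψ) ≪ 𝓛⁻¹¹⁴ ∫_{𝔍(α)} |L(s+β₂,ψ)L(s+β₃,ψ)A(𝐚₁;s,ψ)A(𝐚₂,1−s,ψ̄)ω(s) ds|`

(typed: `Section8aStatements.Step8u012 c′`). The deduction itself is kernel-checked in
`Section8Step8u012.lean`; this file supplies, as theorems only (no definition, no named fact):

* `norm_Zfac_inv_le_exp_of_abs_sub_half_le` — the lower-bound twin of the tree's
  `GammaFactor.norm_Zfac_le_exp_of_abs_sub_half_le` (`Section5Lemma51`): for primitive `θ (mod k)`,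
  `|σ − 1/2| ≤ 1/4`, `t ≥ 4`, `|Z(σ+it,θ)⁻¹| ≤ exp(|σ − 1/2|(|log(kt/2π)| + 14/t))` — the size of the
  factor `(pt₀)^{β₃}Z(s,ψ)⁻¹` of `𝒞` (7.1) on `𝔍(α)` that Lemma 5.2's relative error multiplies;
* `alpha_le_norm_sub_of_prop22i` — on `𝔍(α)` (`σ = 1/2 + α`, `|t − 2πt₀| ≤ 𝓛₁`) every zero `ρ` of
  `L(·,ψ)` is at distance `≥ α` once the zeros of `L(s,ψ)L(s,ψχ)` in `Ω` lie on the line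
  (Proposition 2.2 (i)) — the hypothesis "`|s − ρ| ≫ α`" of Lemma 5.9 on `𝔍(α)`;
* `integrandTilde_sub_integrandC` — the algebra
  `𝒞̃AAω − 𝒞AAω = −i(Y(s+β₁)Y(s+β₂)Y(s+β₃)/Y(s) − (pt₀)^{β₃}Z(s)⁻¹)·(L(s+β₁)/L(s))·L(s+β₂)L(s+β₃)·AAω`;
* `continuousOn_integrandC_J`, `continuousOn_integrandTilde_J` — both integrands are continuous
  along `𝔍(α)` (so the segment integrals are genuine and `Ĩ₁⁺ − I₁⁺` is the integral of the
  difference): `Y(·,ψ)` analytic on the upper half-plane (`Skeleton.Yroot_spec`), `L(·,ψ)` entire,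
  `M(s,ψ) = YL ≠ 0` and `Z(s,ψ) ≠ 0` on `𝔍(α)`, `A`, `ω` continuous (`Ded81Edge.continuous_dirPoly`,
  `continuous_omega`).

WHAT THIS IS NOT: any statement about Theorems 1–2 of the manuscript or about Landau–Siegel zeros.

## References

* Y. Zhang, arXiv:2211.02515v1 (2022), §8 p.43 (tex L2236–L2243); (7.1); §2 (2.13)–(2.15);
  Lemmas 5.2, 5.9. [cite: Zhang2022LandauSiegel, §8 p.43]
-/

noncomputable section

open Complex Real Set MeasureTheory intervalIntegral

namespace Literature.NumberTheory.LFunctions.Zhang2022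

namespace Step8u012Holds

open Skeleton Section8aStatements GammaFactor

/-! ### `|Z(s,θ)⁻¹|` near the critical line -/

/-- **`|Z(σ+it,θ)⁻¹| ≤ exp(|σ − 1/2|(|log(kt/2π)| + 14/t))`** for primitive `θ (mod k)`,
`|σ − 1/2| ≤ 1/4`, `t ≥ 4` — from `|Z(1/2+it,θ)| = 1` and the Stirling bound
`|(Z′/Z)(u+it,θ) + log(kt/2π)| ≤ 14/t` integrated from `1/2 + it` to `σ + it` (as in the tree's
upper bound `norm_Zfac_le_exp_of_abs_sub_half_le`; the size of `Z(s,ψ)⁻¹` in `𝒞(s,ψ)` (7.1) on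
`𝔍(±α)`). [cite: Zhang2022LandauSiegel, §7 (7.1)] -/
theorem norm_Zfac_inv_le_exp_of_abs_sub_half_le {k : ℕ} [NeZero k] {θ : DirichletCharacter ℂ k}
    (hθ : θ.IsPrimitive) {σ t : ℝ} (hσ : |σ - 1 / 2| ≤ 1 / 4) (ht : 4 ≤ t) :
    ‖(Zfac θ ((σ : ℂ) + t * I))⁻¹‖
      ≤ Real.exp (|σ - 1 / 2| * (|Real.log ((k : ℝ) * t / (2 * π))| + 14 / t)) := by
  have ht0 : 0 < t := by linarith
  set a : ℂ := (1 / 2 : ℂ) + t * I with ha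
  set w : ℂ := ((σ - 1 / 2 : ℝ) : ℂ) with hw
  set L : ℝ := Real.log ((k : ℝ) * t / (2 * π)) with hL
  have hpt : ∀ x : ℝ, a + (x : ℂ) * w = ((1 / 2 + x * (σ - 1 / 2) : ℝ) : ℂ) + t * I := by
    intro x; rw [ha, hw]; push_cast; ring
  have hu : ∀ x ∈ Icc (0 : ℝ) 1,
      0 < 1 / 2 + x * (σ - 1 / 2) ∧ 1 / 2 + x * (σ - 1 / 2) ≤ 1 := by
    intro x hx
    have h1 : |x * (σ - 1 / 2)| ≤ 1 / 4 := by
      rw [abs_mul, abs_of_nonneg hx.1]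
      calc x * |σ - 1 / 2| ≤ 1 * (1 / 4) :=
            mul_le_mul hx.2 hσ (abs_nonneg _) zero_le_one
        _ = 1 / 4 := one_mul _
    obtain ⟨h1a, h1b⟩ := abs_le.mp h1
    constructor <;> linarith
  have him : ∀ x : ℝ, 0 < (a + (x : ℂ) * w).im := by
    intro x; rw [hpt]; simpa using ht0
  have hg : ∀ x ∈ Icc (0 : ℝ) 1, AnalyticAt ℂ (Zfac θ) (a + x * w) :=
    fun x _ => analyticAt_Zfac θ (him x)
  have h0 : ∀ x ∈ Icc (0 : ℝ) 1, Zfac θ (a + x * w) ≠ 0 :=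
    fun x _ => Zfac_ne_zero hθ (him x)
  have key := Lemma45.eq_mul_exp_integral_logDeriv_segment hg h0
  have haw : a + w = (σ : ℂ) + t * I := by rw [ha, hw]; push_cast; ring
  have ha1 : ‖Zfac θ a‖ = 1 := norm_Zfac_half_eq_one hθ ht0
  have hpw : ∀ x ∈ Set.uIoc (0 : ℝ) 1,
      ‖deriv (Zfac θ) (a + x * w) / Zfac θ (a + x * w)‖ ≤ |L| + 14 / t := by
    intro x hx
    have hx' : x ∈ Icc (0 : ℝ) 1 := by
      rw [Set.uIoc_of_le zero_le_one] at hx; exact ⟨hx.1.le, hx.2⟩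
    obtain ⟨hu0, hu1⟩ := hu x hx'
    have hlog := norm_logDeriv_Zfac_add_log_le hθ (A := 1) (σ := 1 / 2 + x * (σ - 1 / 2))
      (t := t) (y := 0) le_rfl hu0 hu1 (by linarith) (by rw [abs_zero]; linarith)
    have hpt' : ((1 / 2 + x * (σ - 1 / 2) : ℝ) : ℂ) + t * I + ((0 : ℝ) : ℂ) * I = a + x * w := by
      rw [hpt]; push_cast; ring
    rw [hpt', logDeriv_apply] at hlog
    have h14 : (2 * |(0 : ℝ)| + 4 * 1 + 10) / t = 14 / t := by rw [abs_zero]; ring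
    rw [h14] at hlog
    calc ‖deriv (Zfac θ) (a + x * w) / Zfac θ (a + x * w)‖
        = ‖(deriv (Zfac θ) (a + x * w) / Zfac θ (a + x * w) + (L : ℂ)) - (L : ℂ)‖ := by
          rw [add_sub_cancel_right]
      _ ≤ ‖deriv (Zfac θ) (a + x * w) / Zfac θ (a + x * w) + (L : ℂ)‖ + ‖(L : ℂ)‖ :=
          norm_sub_le _ _
      _ ≤ 14 / t + |L| := by
          rw [Complex.norm_real, Real.norm_eq_abs]
          exact add_le_add hlog le_rfl
      _ = |L| + 14 / t := add_comm _ _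
  have hint := intervalIntegral.norm_integral_le_of_norm_le_const hpw
  rw [sub_zero, abs_one, mul_one] at hint
  rw [← haw, key, mul_inv, norm_mul, norm_inv, ha1, inv_one, one_mul, ← Complex.exp_neg,
    Complex.norm_exp]
  refine Real.exp_le_exp.mpr ?_
  calc (-(w * ∫ x in (0 : ℝ)..1, deriv (Zfac θ) (a + x * w) / Zfac θ (a + x * w))).re
      ≤ ‖-(w * ∫ x in (0 : ℝ)..1, deriv (Zfac θ) (a + x * w) / Zfac θ (a + x * w))‖ :=
        Complex.re_le_norm _
    _ = |σ - 1 / 2| * ‖∫ x in (0 : ℝ)..1, deriv (Zfac θ) (a + x * w) / Zfac θ (a + x * w)‖ := by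
        rw [norm_neg, norm_mul, hw, Complex.norm_real, Real.norm_eq_abs]
    _ ≤ |σ - 1 / 2| * (|L| + 14 / t) := by gcongr

/-! ### The zeros of `L(·,ψ)` seen from `𝔍(α)` -/

/-- **"`|s − ρ| ≫ α` on `𝔍(α)`"** (the hypothesis of Lemma 5.9 at the use site p.42–43): if the zeros
of `L(s,ψ)L(s,ψχ)` in `Ω` lie on the critical line (Proposition 2.2 (i) at `ψ`) and `α ≤ 1/4`, then
for `Re s = 1/2 + α`, `|Im s − 2πt₀| ≤ 𝓛₁`, every zero `ρ` of `L(·,ψ)` has `|s − ρ| ≥ α` (zeros in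
`Ω` are at horizontal distance `α`; the others are at distance `≥ 1/2 − α` or `≥ 2`).
[cite: Zhang2022LandauSiegel, §8 p.42, tex L2200–2201] -/
theorem alpha_le_norm_sub_of_prop22i {D : ℕ} [NeZero D] (χ : DirichletCharacter ℂ D) (x : Chr D)
    (hα0 : 0 ≤ alpha D) (hα : alpha D ≤ 1 / 4)
    (hi : ∀ s ∈ prodZeroSetOmega χ x, s.re = 1 / 2) {s : ℂ} (hsre : s.re = 1 / 2 + alpha D)
    (hsim : |s.im - 2 * π * t0 D| ≤ ell1 D) :
    ∀ ρ : ℂ, x.ψ.LFunction ρ = 0 → alpha D ≤ ‖s - ρ‖ := by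
  intro ρ hρ
  have hre := Complex.abs_re_le_norm (s - ρ)
  have him := Complex.abs_im_le_norm (s - ρ)
  rw [Complex.sub_re] at hre
  rw [Complex.sub_im] at him
  by_cases hΩ : ρ ∈ Omega D
  · have hρΩ : ρ ∈ prodZeroSetOmega χ x := ⟨hΩ, by rw [hρ, zero_mul]⟩
    have h := hi ρ hρΩ
    rw [hsre, h, show (1 : ℝ) / 2 + alpha D - 1 / 2 = alpha D by ring, abs_of_nonneg hα0] at hre
    exact hre
  · have e1 : (ρ - s0 D).re = ρ.re - 1 / 2 := by simp [s0, SmoothWeight.s0_def]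
    have e2 : (ρ - s0 D).im = ρ.im - 2 * π * t0 D := by simp [s0, SmoothWeight.s0_def]
    simp only [Omega, Set.mem_setOf_eq, e1, e2, not_and_or, not_lt] at hΩ
    rcases hΩ with h | h
    · -- `|Re ρ − 1/2| ≥ 1/2`: horizontal distance `≥ 1/2 − α ≥ α`
      have h1 : |ρ.re - 1 / 2| - alpha D ≤ |s.re - ρ.re| := by
        rw [hsre]
        have := abs_sub_abs_le_abs_sub (ρ.re - 1 / 2) (alpha D)
        rw [abs_of_nonneg hα0] at this
        calc |ρ.re - 1 / 2| - alpha D ≤ |ρ.re - 1 / 2 - alpha D| := this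
          _ = |1 / 2 + alpha D - ρ.re| := by
              rw [show ρ.re - 1 / 2 - alpha D = -(1 / 2 + alpha D - ρ.re) by ring, abs_neg]
      linarith
    · -- `|Im ρ − 2πt₀| ≥ 𝓛₁ + 2`: vertical distance `≥ 2 ≥ α`
      have h1 : (ell1 D + 2) - ell1 D ≤ |s.im - ρ.im| := by
        have := abs_sub_abs_le_abs_sub (ρ.im - 2 * π * t0 D) (s.im - 2 * π * t0 D)
        rw [show ρ.im - 2 * π * t0 D - (s.im - 2 * π * t0 D) = -(s.im - ρ.im) by ring,
          abs_neg] at this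
        linarith
      linarith

/-! ### The algebra of the integrand difference -/

variable {c' : ℝ} {D : ℕ} (x : Chr D)

/-- **`𝒞̃AAω − 𝒞AAω`, factored**: with `M = YL`,
`𝒞̃(s) − 𝒞(s) = −i(Y(s+β₁)Y(s+β₂)Y(s+β₃)/Y(s) − (pt₀)^{β₃}Z(s)⁻¹)·(L(s+β₁)/L(s))·L(s+β₂)L(s+β₃)`,
so the integrands of `Ĩ₁⁺` and `I₁⁺` differ by that times `A(𝐚₁;s)A(𝐚₂,1−s)ω(s)` — the form on which
Lemma 5.2 (first factor) and Lemma 5.9 (second factor) act. [cite: Zhang2022LandauSiegel, §8 p.43, tex L2240–2243] -/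
theorem integrandTilde_sub_integrandC (a₁ a₂ : ℕ → ℂ) (s : ℂ) :
    integrandTilde c' x a₁ a₂ s - integrandC c' x a₁ a₂ s =
      -I * (Yroot x.ψ (s + beta1 c' D) * Yroot x.ψ (s + beta2 c' D) * Yroot x.ψ (s + beta3 c' D) /
              Yroot x.ψ s -
            (((x.p : ℝ) * t0 D : ℝ) : ℂ) ^ beta3 c' D * (Zfac x.ψ s)⁻¹) *
        (x.ψ.LFunction (s + beta1 c' D) / x.ψ.LFunction s) *
        (x.ψ.LFunction (s + beta2 c' D) * x.ψ.LFunction (s + beta3 c' D)) *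
        (Apoly x a₁ s * ApolyBar x a₂ (1 - s) * omegaW D s) := by
  simp only [integrandTilde, integrandC, calCt, frakcW, Mfun]
  ring

/-- `|(pt₀)^{β₃}| = 1`: `β₃ = 3iα(1 − c′α𝓛)` is purely imaginary and `pt₀ > 0`.
[cite: Zhang2022LandauSiegel, §2 (2.13)] -/
theorem norm_cpow_beta3 (hD : 0 < t0 D) :
    ‖(((x.p : ℝ) * t0 D : ℝ) : ℂ) ^ beta3 c' D‖ = 1 := by
  have hp : (0 : ℝ) < (x.p : ℝ) * t0 D := mul_pos (by exact_mod_cast x.prime.pos) hD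
  rw [Complex.norm_cpow_eq_rpow_re_of_pos hp]
  have hre : (beta3 c' D).re = 0 := by simp [beta3]
  rw [hre, Real.rpow_zero]

/-! ### Continuity of the two integrands along `𝔍(α)` -/

omit x in
/-- The parametrisation `v ↦ α + s₀ + iv` of `𝔍(α)` is continuous. [cite: Zhang2022LandauSiegel, §7 p.33 (`𝔍(z)`)] -/
theorem continuous_sv (D : ℕ) : Continuous fun v : ℝ => (alpha D : ℂ) + s0 D + v * I := by
  fun_prop

omit x in
/-- Points of `𝔍(α)` shifted by `iy`, `|y| ≤ 1`, `|v| ≤ 𝓛₁`, have positive imaginary part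
(`2πt₀ − 𝓛₁ − 1 > 0` as soon as `𝓛 ≥ 1`). [cite: Zhang2022LandauSiegel, §7 p.33 (`𝔍(z)`)] -/
theorem im_sv_add_pos {D : ℕ} (hL : 1 ≤ ell D) {v y : ℝ} (hv : |v| ≤ ell1 D) (hy : |y| ≤ 1) :
    0 < ((alpha D : ℂ) + s0 D + v * I + y * I).im := by
  have e : ((alpha D : ℂ) + s0 D + v * I + y * I).im = 2 * π * t0 D + v + y := by
    simp [s0, SmoothWeight.s0_def]
  rw [e]
  have h519 : ell1 D ≤ t0 D := by
    rw [ell1, t0]; exact pow_le_pow_right₀ hL (by norm_num)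
  have h1 : 1 ≤ t0 D := by rw [t0]; exact one_le_pow₀ hL
  have hv' := (abs_le.mp hv).1
  have hy' := (abs_le.mp hy).1
  nlinarith [Real.pi_gt_three]

/-- **The integrand `𝒞AAω` of `I₁⁺` is continuous along `𝔍(α)`** on any parameter set where
`L(s,ψ) ≠ 0` (and `𝓛 ≥ 1`): `Z(·,ψ)` analytic and non-zero on the upper half-plane,
`L(·,ψ)` entire, `A`, `ω` continuous. [cite: Zhang2022LandauSiegel, §8 p.43, tex L2236–2239] -/
theorem continuousOn_integrandC_J (hL : 1 ≤ ell D) (a₁ a₂ : ℕ → ℂ) {S : Set ℝ}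
    (hS : S ⊆ Icc (-ell1 D) (ell1 D))
    (hL0 : ∀ v ∈ S, x.ψ.LFunction ((alpha D : ℂ) + s0 D + v * I) ≠ 0) :
    ContinuousOn (fun v : ℝ => integrandC c' x a₁ a₂ ((alpha D : ℂ) + s0 D + v * I)) S := by
  have hsv := continuous_sv D
  have hLc : Continuous x.ψ.LFunction := Ded81Edge.continuous_LFunction_chr x
  have hvabs : ∀ v ∈ S, |v| ≤ ell1 D := fun v hv => abs_le.mpr ⟨(hS hv).1, (hS hv).2⟩
  -- `Z(s,ψ)⁻¹` is continuous on `S` (analytic, non-zero on the upper half-plane)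
  have hZon : ContinuousOn (Zfac x.ψ) {s : ℂ | 0 < s.im} := fun s hs =>
    (analyticAt_Zfac x.ψ hs).continuousAt.continuousWithinAt
  have hZ : ContinuousOn (fun v : ℝ => (Zfac x.ψ ((alpha D : ℂ) + s0 D + v * I))⁻¹) S := by
    refine ContinuousOn.inv₀ ?_ ?_
    · refine hZon.comp hsv.continuousOn fun v hv => ?_
      have := im_sv_add_pos hL (hvabs v hv) (y := 0) (by norm_num)
      simpa using this
    · intro v hv
      have him : 0 < ((alpha D : ℂ) + s0 D + v * I).im := by
        have := im_sv_add_pos hL (hvabs v hv) (y := 0) (by norm_num)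
        simpa using this
      exact Zfac_ne_zero x.prim him
  have hA1 : Continuous fun v : ℝ => Apoly x a₁ ((alpha D : ℂ) + s0 D + v * I) :=
    (Ded81Edge.continuous_dirPoly (Nsupp D) a₁ x.ψ x.p_ne_one).comp hsv
  have hA2 : Continuous fun v : ℝ => ApolyBar x a₂ (1 - ((alpha D : ℂ) + s0 D + v * I)) :=
    (Ded81Edge.continuous_dirPoly (Nsupp D) a₂ x.ψ⁻¹ x.p_ne_one).comp (continuous_const.sub hsv)
  have hω : Continuous fun v : ℝ => omegaW D ((alpha D : ℂ) + s0 D + v * I) :=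
    (Ded81Edge.continuous_omega (ell2 D) (t0 D)).comp hsv
  have hL1 : Continuous fun v : ℝ => x.ψ.LFunction ((alpha D : ℂ) + s0 D + v * I + beta1 c' D) :=
    hLc.comp (hsv.add continuous_const)
  have hL2 : Continuous fun v : ℝ => x.ψ.LFunction ((alpha D : ℂ) + s0 D + v * I + beta2 c' D) :=
    hLc.comp (hsv.add continuous_const)
  have hL3 : Continuous fun v : ℝ => x.ψ.LFunction ((alpha D : ℂ) + s0 D + v * I + beta3 c' D) :=
    hLc.comp (hsv.add continuous_const)
  have hLs : ContinuousOn (fun v : ℝ => x.ψ.LFunction ((alpha D : ℂ) + s0 D + v * I)) S :=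
    (hLc.comp hsv).continuousOn
  have h : ContinuousOn (fun v : ℝ =>
      -I * (((x.p : ℝ) * t0 D : ℝ) : ℂ) ^ beta3 c' D * (Zfac x.ψ ((alpha D : ℂ) + s0 D + v * I))⁻¹ *
        (x.ψ.LFunction ((alpha D : ℂ) + s0 D + v * I + beta1 c' D) *
          x.ψ.LFunction ((alpha D : ℂ) + s0 D + v * I + beta2 c' D) *
          x.ψ.LFunction ((alpha D : ℂ) + s0 D + v * I + beta3 c' D)) /
        x.ψ.LFunction ((alpha D : ℂ) + s0 D + v * I) *
      Apoly x a₁ ((alpha D : ℂ) + s0 D + v * I) *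
      ApolyBar x a₂ (1 - ((alpha D : ℂ) + s0 D + v * I)) *
      omegaW D ((alpha D : ℂ) + s0 D + v * I)) S := by
    refine ContinuousOn.mul (ContinuousOn.mul (ContinuousOn.mul ?_ hA1.continuousOn)
      hA2.continuousOn) hω.continuousOn
    refine ContinuousOn.div ?_ hLs hL0
    exact ((continuousOn_const.mul hZ).mul ((hL1.mul hL2).mul hL3).continuousOn)
  refine h.congr fun v _ => ?_
  simp only [integrandC, frakcW]

/-- `Y(s,ψ) ≠ 0` on the upper half-plane (`Y² = Z⁻¹`, `Z ≠ 0`). [cite: Zhang2022LandauSiegel, §2 p.5] -/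
theorem Yroot_ne_zero {s : ℂ} (hs : 0 < s.im) : Yroot x.ψ s ≠ 0 := by
  intro h0
  have h := (Yroot_spec x.prim).2 s hs
  rw [h0, zero_pow two_ne_zero] at h
  exact inv_ne_zero (Zfac_ne_zero x.prim hs) h.symm

/-- **The integrand `𝒞̃AAω` of `Ĩ₁⁺` is continuous along `𝔍(α)`** on any parameter set where
`L(s,ψ) ≠ 0` (and `𝓛 ≥ 1`, `|b_j| ≤ 1`): `Y(·,ψ)` analytic on the upper half-plane and non-zero,
`M = YL`. [cite: Zhang2022LandauSiegel, §8 p.42, tex L2208–2210] -/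
theorem continuousOn_integrandTilde_J (hL : 1 ≤ ell D) (hb1 : |b1 c' D| ≤ 1) (hb2 : |b2 c' D| ≤ 1)
    (hb3 : |b3 c' D| ≤ 1) (a₁ a₂ : ℕ → ℂ) {S : Set ℝ} (hS : S ⊆ Icc (-ell1 D) (ell1 D))
    (hL0 : ∀ v ∈ S, x.ψ.LFunction ((alpha D : ℂ) + s0 D + v * I) ≠ 0) :
    ContinuousOn (fun v : ℝ => integrandTilde c' x a₁ a₂ ((alpha D : ℂ) + s0 D + v * I)) S := by
  obtain ⟨e1, e2, e3⟩ := beta_eq_b_mul_I c' D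
  have hsv := continuous_sv D
  have hLc : Continuous x.ψ.LFunction := Ded81Edge.continuous_LFunction_chr x
  have hvabs : ∀ v ∈ S, |v| ≤ ell1 D := fun v hv => abs_le.mpr ⟨(hS hv).1, (hS hv).2⟩
  have hYd : ContinuousOn (Yroot x.ψ) {s : ℂ | 0 < s.im} := (Yroot_spec x.prim).1.continuousOn
  -- imaginary parts along the (shifted) segment are positive
  have him0 : ∀ v ∈ S, 0 < ((alpha D : ℂ) + s0 D + v * I).im := fun v hv => by
    have := im_sv_add_pos hL (hvabs v hv) (y := 0) (by norm_num); simpa using this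
  have him1 : ∀ v ∈ S, 0 < ((alpha D : ℂ) + s0 D + v * I + beta1 c' D).im := fun v hv => by
    rw [e1]; exact im_sv_add_pos hL (hvabs v hv) hb1
  have him2 : ∀ v ∈ S, 0 < ((alpha D : ℂ) + s0 D + v * I + beta2 c' D).im := fun v hv => by
    rw [e2]; exact im_sv_add_pos hL (hvabs v hv) hb2
  have him3 : ∀ v ∈ S, 0 < ((alpha D : ℂ) + s0 D + v * I + beta3 c' D).im := fun v hv => by
    rw [e3]; exact im_sv_add_pos hL (hvabs v hv) hb3
  -- `M(· + β_j)` and `M(·)` continuous on `S`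
  have hM : ∀ β : ℂ, (∀ v ∈ S, 0 < ((alpha D : ℂ) + s0 D + v * I + β).im) →
      ContinuousOn (fun v : ℝ => Mfun x.ψ ((alpha D : ℂ) + s0 D + v * I + β)) S := by
    intro β hβ
    have hY : ContinuousOn (fun v : ℝ => Yroot x.ψ ((alpha D : ℂ) + s0 D + v * I + β)) S :=
      hYd.comp (hsv.add continuous_const).continuousOn fun v hv => hβ v hv
    have hLβ : Continuous fun v : ℝ => x.ψ.LFunction ((alpha D : ℂ) + s0 D + v * I + β) :=
      hLc.comp (hsv.add continuous_const)
    exact (hY.mul hLβ.continuousOn).congr fun v _ => by simp only [Mfun, Pi.mul_apply]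
  have hM0 : ContinuousOn (fun v : ℝ => Mfun x.ψ ((alpha D : ℂ) + s0 D + v * I)) S := by
    have := hM 0 (fun v hv => by rw [add_zero]; exact him0 v hv)
    exact this.congr fun v _ => by simp only [add_zero]
  have hM0ne : ∀ v ∈ S, Mfun x.ψ ((alpha D : ℂ) + s0 D + v * I) ≠ 0 := fun v hv =>
    mul_ne_zero (Yroot_ne_zero x (him0 v hv)) (hL0 v hv)
  have hA1 : Continuous fun v : ℝ => Apoly x a₁ ((alpha D : ℂ) + s0 D + v * I) :=
    (Ded81Edge.continuous_dirPoly (Nsupp D) a₁ x.ψ x.p_ne_one).comp hsv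
  have hA2 : Continuous fun v : ℝ => ApolyBar x a₂ (1 - ((alpha D : ℂ) + s0 D + v * I)) :=
    (Ded81Edge.continuous_dirPoly (Nsupp D) a₂ x.ψ⁻¹ x.p_ne_one).comp (continuous_const.sub hsv)
  have hω : Continuous fun v : ℝ => omegaW D ((alpha D : ℂ) + s0 D + v * I) :=
    (Ded81Edge.continuous_omega (ell2 D) (t0 D)).comp hsv
  have h : ContinuousOn (fun v : ℝ =>
      -I * (Mfun x.ψ ((alpha D : ℂ) + s0 D + v * I + beta1 c' D) *
          Mfun x.ψ ((alpha D : ℂ) + s0 D + v * I + beta2 c' D) *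
          Mfun x.ψ ((alpha D : ℂ) + s0 D + v * I + beta3 c' D)) /
        Mfun x.ψ ((alpha D : ℂ) + s0 D + v * I) *
      Apoly x a₁ ((alpha D : ℂ) + s0 D + v * I) *
      ApolyBar x a₂ (1 - ((alpha D : ℂ) + s0 D + v * I)) *
      omegaW D ((alpha D : ℂ) + s0 D + v * I)) S := by
    refine ContinuousOn.mul (ContinuousOn.mul (ContinuousOn.mul ?_ hA1.continuousOn)
      hA2.continuousOn) hω.continuousOn
    refine ContinuousOn.div ?_ hM0 hM0ne
    exact continuousOn_const.mul (((hM _ him1).mul (hM _ him2)).mul (hM _ him3))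
  refine h.congr fun v _ => ?_
  simp only [integrandTilde, calCt]

end Step8u012Holds

end Literature.NumberTheory.LFunctions.Zhang2022
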